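import Mathlib
import HarnessLib
import Summits.Ventures.LatticeQCDFlow.Scaling.TorusPlaquetteLastLinks
import Summits.Ventures.LatticeQCDFlow.Scaling.Wilson2DU1PlaquetteDensity
import Summits.Ventures.LatticeQCDFlow.Runbook.LatticeQCDFlowSanity

/-!
# LatticeQCDFlow / Scaling — the parity bound for ranked plaquette structures of `(ℤ/L)^d`:
# `#B + #sites ≤ #links + 1`, so at least `(d−1)(d−2)/2·L^d − 1` plaquettes stay outside — the
# leading term of the layers, in every dimension

HONEST FRAMING: exact (Metropolis-corrected) sampling algorithms for lattice gauge theory;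
figures of merit are autocorrelation/cost numbers at stated couplings and volumes; no
continuum-physics claim.

Venture `LatticeQCDFlow` (cell pub-lqcd), topic `Scaling`, FANOUT row 30 (lean-1, GEN-24) — OUR WORK on
THEORY-2.md §4 row C5.  A collection `B` of plaquettes of `(ℤ/L)^d` RANKED for a top-link assignment `t`
(`t p` a link of `p`; `rank p < rank p'` whenever `t p` lies on another `p' ∈ B`) carries an exact
one-plaquette heat-bath autoregression (`Scaling/AutoregressiveGaugeHeatBathRanked`), and the `k = #Bᶜ`
plaquettes outside ride on the importance ratio (`…AnyDim`); `…DimensionGap`: `k ≥ #plaquettes/6` (`d ≥ 3`,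
cube counting); `TorusRankedLayers`: `k = (d−1)(d−2)/2·L^d + (d−1)L^{d−1}` attained.  Here LINEAR ALGEBRA
OVER `ℤ/2` closes the gap to leading order:

* §1 `boundaryVec p = 𝟙_{(x,i)} + 𝟙_{(x+e_i,j)} + 𝟙_{(x+e_j,i)} + 𝟙_{(x,j)} : links → ℤ/2` (written as a sum of
  four `Pi.single`s); **`linearIndependent_boundaryVec_of_ranked`** — on a ranked `B` these vectors are
  linearly independent (evaluate a vanishing combination at the top link of its MAXIMAL-rank plaquette:
  no other plaquette of the combination contains it; `L ≥ 2` makes the four links distinct);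
* §2 the vertex-parity map `vertexParity f y = Σ_i (f(y,i) + f(y−e_i,i))` is linear and kills every
  `boundaryVec p` (each corner of a plaquette meets two of its links) — **`vertexParity_boundaryVec`**;
* §3 **`card_site_le_finrank_range_vertexParity_add_one`** — `rank(vertexParity) ≥ #sites − 1`: the
  lattice path from `0` to `y` (straight segments, direction by direction) is mapped to `𝟙_0 + 𝟙_y`, and
  these are independent for `y ≠ 0`;
* §4 **`card_add_card_site_le_card_edge_add_one_of_ranked`** — `#B + #sites ≤ #links + 1` for every
  ranked `B` (rank–nullity); hence **`card_plaquette_add_card_site_le_of_ranked`** —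
  `#plaquettes + #sites ≤ k + #links + 1`, i.e. `k ≥ (d−1)(d−2)/2·L^d − 1`; in `d = 3`:
  **`pow_three_le_card_compl_add_one_of_ranked`** — `L³ ≤ k + 1` (against `L³/2` from cube counting and
  `L³ + 2L²` attained by the layers).

No `def` (the boundary vectors and the vertex-parity map are spelled out as terms), no `sorry`, nothing
cited as a fact beyond the tree.
-/

namespace Summit.Ventures.LatticeQCDFlow.Theory2.Autoregressive

open Finset
open Literature.MathematicalPhysics.QuantumFieldTheory

variable {d L : ℕ} [NeZero L]

/-! ## §1 Boundary vectors over `ℤ/2` and their independence on ranked collections -/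

omit [NeZero L] in
/-- The value of the boundary vector `𝟙_{(x,i)} + 𝟙_{(x+e_i,j)} + 𝟙_{(x+e_j,i)} + 𝟙_{(x,j)}` of a plaquette
at a link off the plaquette is `0`. [ours] -/
theorem boundaryVec_apply_of_notMem (p : Plaquette d L) {e : Edge d L}
    (he : e ∉ ({(p.1, p.2.1.1), (p.1.shift p.2.1.1, p.2.1.2), (p.1.shift p.2.1.2, p.2.1.1), (p.1, p.2.1.2)} :
      Finset (Edge d L))) :
    ((Pi.single (p.1, p.2.1.1) 1 + Pi.single (p.1.shift p.2.1.1, p.2.1.2) 1 +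
        Pi.single (p.1.shift p.2.1.2, p.2.1.1) 1 + Pi.single (p.1, p.2.1.2) 1 : Edge d L → ZMod 2) e) = 0 := by
  simp only [Finset.mem_insert, Finset.mem_singleton, not_or] at he
  obtain ⟨h1, h2, h3, h4⟩ := he
  simp [h1, h2, h3, h4]

omit [NeZero L] in
/-- At its own links (`L ≥ 2`: the four links are pairwise distinct) the boundary vector is `1`. [ours] -/
theorem boundaryVec_apply_of_mem (hL : 2 ≤ L) (p : Plaquette d L) {e : Edge d L}
    (he : e ∈ ({(p.1, p.2.1.1), (p.1.shift p.2.1.1, p.2.1.2), (p.1.shift p.2.1.2, p.2.1.1), (p.1, p.2.1.2)} :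
      Finset (Edge d L))) :
    ((Pi.single (p.1, p.2.1.1) 1 + Pi.single (p.1.shift p.2.1.1, p.2.1.2) 1 +
        Pi.single (p.1.shift p.2.1.2, p.2.1.1) 1 + Pi.single (p.1, p.2.1.2) 1 : Edge d L → ZMod 2) e) = 1 := by
  obtain ⟨x, ⟨⟨i, j⟩, hij⟩⟩ := p
  have hij' : i ≠ j := ne_of_lt hij
  have hsi : x.shift i ≠ x := site_shift_ne hL x i
  have hsj : x.shift j ≠ x := site_shift_ne hL x j
  have n12 : ((x, i) : Edge d L) ≠ (x.shift i, j) := fun h => hij' (congrArg Prod.snd h)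
  have n13 : ((x, i) : Edge d L) ≠ (x.shift j, i) := fun h => hsj (congrArg Prod.fst h).symm
  have n14 : ((x, i) : Edge d L) ≠ (x, j) := fun h => hij' (congrArg Prod.snd h)
  have n23 : ((x.shift i, j) : Edge d L) ≠ (x.shift j, i) := fun h => hij' (congrArg Prod.snd h).symm
  have n24 : ((x.shift i, j) : Edge d L) ≠ (x, j) := fun h => hsi (congrArg Prod.fst h)
  have n34 : ((x.shift j, i) : Edge d L) ≠ (x, j) := fun h => hij' (congrArg Prod.snd h)
  simp only [Finset.mem_insert, Finset.mem_singleton] at he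
  simp only at he ⊢
  rcases he with rfl | rfl | rfl | rfl
  · simp [n12, n13, n14]
  · simp [n12.symm, n23, n24]
  · simp [n13.symm, n23.symm, n34]
  · simp [n14.symm, n24.symm, n34.symm]

omit [NeZero L] in
/-- **The boundary vectors of a ranked collection are linearly independent over `ℤ/2`.**  `L ≥ 2`; `t p`
a link of `p` for `p ∈ B` and `rank p < rank p'` whenever `t p` lies on another `p' ∈ B`.  A vanishing
combination, evaluated at the top link of its maximal-rank plaquette, has exactly one non-zero term there.
[ours] -/
theorem linearIndependent_boundaryVec_of_ranked (hL : 2 ≤ L) (B : Finset (Plaquette d L))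
    (t : Plaquette d L → Edge d L)
    (ht : ∀ p ∈ B, t p ∈ ({(p.1, p.2.1.1), (p.1.shift p.2.1.1, p.2.1.2),
        (p.1.shift p.2.1.2, p.2.1.1), (p.1, p.2.1.2)} : Finset (Edge d L)))
    (rank : Plaquette d L → ℕ)
    (hrank : ∀ p ∈ B, ∀ p' ∈ B, p ≠ p' → t p ∈ ({(p'.1, p'.2.1.1), (p'.1.shift p'.2.1.1, p'.2.1.2),
        (p'.1.shift p'.2.1.2, p'.2.1.1), (p'.1, p'.2.1.2)} : Finset (Edge d L)) → rank p < rank p') :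
    LinearIndependent (ZMod 2) (fun p : B =>
      (Pi.single ((p : Plaquette d L).1, (p : Plaquette d L).2.1.1) 1 +
        Pi.single ((p : Plaquette d L).1.shift (p : Plaquette d L).2.1.1, (p : Plaquette d L).2.1.2) 1 +
        Pi.single ((p : Plaquette d L).1.shift (p : Plaquette d L).2.1.2, (p : Plaquette d L).2.1.1) 1 +
        Pi.single ((p : Plaquette d L).1, (p : Plaquette d L).2.1.2) 1 : Edge d L → ZMod 2)) := by
  classical
  rw [Fintype.linearIndependent_iff]
  intro g hg
  by_contra hne
  push Not at hne
  obtain ⟨i₀, hi₀⟩ := hne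
  set S : Finset B := Finset.univ.filter (fun i => g i ≠ 0) with hS
  have hSne : S.Nonempty := ⟨i₀, by simp [hS, hi₀]⟩
  obtain ⟨m, hmS, hmax⟩ := S.exists_max_image (fun i => rank (i : Plaquette d L)) hSne
  have hgm : g m ≠ 0 := (Finset.mem_filter.1 hmS).2
  -- evaluate the vanishing combination at the top link of `m`
  have heval := congrArg (fun f : Edge d L → ZMod 2 => f (t m)) hg
  simp only [Finset.sum_apply, Pi.smul_apply, smul_eq_mul, Pi.zero_apply] at heval
  rw [Finset.sum_eq_single m] at heval
  · rw [boundaryVec_apply_of_mem hL (m : Plaquette d L) (ht m m.2), mul_one] at heval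
    exact hgm heval
  · intro i _ him
    by_cases hgi : g i = 0
    · rw [hgi, zero_mul]
    · -- `i` has a non-zero coefficient, so `rank i ≤ rank m`; if `t m` lay on `i` then `rank m < rank i`
      have hiS : i ∈ S := Finset.mem_filter.2 ⟨Finset.mem_univ _, hgi⟩
      have hle := hmax i hiS
      have hnot : t m ∉ ({((i : Plaquette d L).1, (i : Plaquette d L).2.1.1),
          ((i : Plaquette d L).1.shift (i : Plaquette d L).2.1.1, (i : Plaquette d L).2.1.2),
          ((i : Plaquette d L).1.shift (i : Plaquette d L).2.1.2, (i : Plaquette d L).2.1.1),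
          ((i : Plaquette d L).1, (i : Plaquette d L).2.1.2)} : Finset (Edge d L)) := by
        intro hmem
        have hne' : (m : Plaquette d L) ≠ (i : Plaquette d L) := fun h => him (Subtype.ext h).symm
        have := hrank m m.2 i i.2 hne' hmem
        omega
      rw [boundaryVec_apply_of_notMem (i : Plaquette d L) hnot, mul_zero]
  · intro h; exact absurd (Finset.mem_univ m) h

/-! ## §2 The vertex-parity map kills every boundary vector -/

omit [NeZero L] in
/-- The vertex-parity map `f ↦ (y ↦ Σ_i (f(y, i) + f(y − e_i, i)))` as a `ℤ/2`-linear map. [ours] -/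
theorem vertexParity_isLinear :
    IsLinearMap (ZMod 2) (fun f : Edge d L → ZMod 2 =>
      fun y : Site d L => ∑ i : Fin d, (f (y, i) + f (y - Pi.single i 1, i))) := by
  constructor
  · intro f g; ext y
    simp only [Pi.add_apply, ← Finset.sum_add_distrib]
    exact Finset.sum_congr rfl fun i _ => by ring
  · intro c f; ext y
    simp only [Pi.smul_apply, smul_eq_mul, Finset.mul_sum, mul_add]

omit [NeZero L] in
/-- The vertex parity of a single link `𝟙_{(x,i)}` is `𝟙_x + 𝟙_{x+e_i}` (its two endpoints). [ours] -/
theorem vertexParity_single (x : Site d L) (i : Fin d) :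
    (fun y : Site d L => ∑ k : Fin d,
        ((Pi.single (x, i) 1 : Edge d L → ZMod 2) (y, k) +
          (Pi.single (x, i) 1 : Edge d L → ZMod 2) (y - Pi.single k 1, k))) =
      (Pi.single x 1 + Pi.single (x.shift i) 1 : Site d L → ZMod 2) := by
  classical
  ext y
  have h1 : ∑ k : Fin d, (Pi.single (x, i) 1 : Edge d L → ZMod 2) (y, k) =
      (Pi.single x 1 : Site d L → ZMod 2) y := by
    rw [Finset.sum_eq_single i]
    · by_cases hy : y = x
      · subst hy; simp
      · have : ((y, i) : Edge d L) ≠ (x, i) := fun h => hy (congrArg Prod.fst h)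
        simp [this, hy]
    · intro k _ hk
      have : ((y, k) : Edge d L) ≠ (x, i) := fun h => hk (congrArg Prod.snd h)
      simp [this]
    · intro h; exact absurd (Finset.mem_univ i) h
  have h2 : ∑ k : Fin d, (Pi.single (x, i) 1 : Edge d L → ZMod 2) (y - Pi.single k 1, k) =
      (Pi.single (x.shift i) 1 : Site d L → ZMod 2) y := by
    rw [Finset.sum_eq_single i]
    · by_cases hy : y = x.shift i
      · subst hy
        have : (x.shift i - Pi.single i 1 : Site d L) = x := by simp [Site.shift]
        simp [this]
      · have hne : (y - Pi.single i 1 : Site d L) ≠ x := by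
          intro h; apply hy; rw [← h]; simp [Site.shift]
        have : ((y - Pi.single i 1, i) : Edge d L) ≠ (x, i) := fun h => hne (congrArg Prod.fst h)
        simp [this, hy]
    · intro k _ hk
      have : ((y - Pi.single k 1, k) : Edge d L) ≠ (x, i) := fun h => hk (congrArg Prod.snd h)
      simp [this]
    · intro h; exact absurd (Finset.mem_univ i) h
  rw [Finset.sum_add_distrib, h1, h2, Pi.add_apply]

omit [NeZero L] in
/-- **Every boundary vector has zero vertex parity**: each corner of a plaquette meets exactly two of its
links (`x + e_i + e_j = x + e_j + e_i`; arithmetic in `ℤ/2`). [ours] -/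
theorem vertexParity_boundaryVec (p : Plaquette d L) :
    (fun y : Site d L => ∑ k : Fin d,
        ((Pi.single (p.1, p.2.1.1) 1 + Pi.single (p.1.shift p.2.1.1, p.2.1.2) 1 +
            Pi.single (p.1.shift p.2.1.2, p.2.1.1) 1 + Pi.single (p.1, p.2.1.2) 1 : Edge d L → ZMod 2) (y, k) +
          (Pi.single (p.1, p.2.1.1) 1 + Pi.single (p.1.shift p.2.1.1, p.2.1.2) 1 +
            Pi.single (p.1.shift p.2.1.2, p.2.1.1) 1 + Pi.single (p.1, p.2.1.2) 1 : Edge d L → ZMod 2)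
            (y - Pi.single k 1, k))) = 0 := by
  classical
  have hlin := (vertexParity_isLinear (d := d) (L := L))
  have hadd : ∀ f g : Edge d L → ZMod 2,
      (fun y : Site d L => ∑ k : Fin d, ((f + g) (y, k) + (f + g) (y - Pi.single k 1, k))) =
        (fun y : Site d L => ∑ k : Fin d, (f (y, k) + f (y - Pi.single k 1, k))) +
          (fun y : Site d L => ∑ k : Fin d, (g (y, k) + g (y - Pi.single k 1, k))) := hlin.map_add
  rw [hadd, hadd, hadd, vertexParity_single, vertexParity_single, vertexParity_single, vertexParity_single]
  have hcomm : (p.1.shift p.2.1.1).shift p.2.1.2 = (p.1.shift p.2.1.2).shift p.2.1.1 := by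
    simp only [Site.shift]; abel
  ext y
  simp only [Pi.add_apply, Pi.zero_apply, hcomm]
  -- every term appears twice: `a + b + (b + e) + (c + e) + (a + c) = 0` in characteristic two
  have key : ∀ a b c e : ZMod 2, a + b + (b + e) + (c + e) + (a + c) = 0 := by decide
  exact key _ _ _ _

/-! ## §3 The vertex-parity map has rank at least `#sites − 1` -/

omit [NeZero L] in
/-- Telescoping of endpoint indicators in characteristic two: `(𝟙_a + 𝟙_b) + (𝟙_b + 𝟙_c) = 𝟙_a + 𝟙_c`. [ours] -/
theorem single_add_single_telescope (a b c : Site d L) :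
    (Pi.single a 1 + Pi.single b 1 : Site d L → ZMod 2) + (Pi.single b 1 + Pi.single c 1) =
      Pi.single a 1 + Pi.single c 1 := by
  ext w
  simp only [Pi.add_apply]
  have key : ∀ u v r : ZMod 2, u + v + (v + r) = u + r := by decide
  exact key _ _ _

/-- A lattice path from `0` to `y` — direction by direction, `(y k).val` unit steps in direction `k` — is
mapped by the vertex-parity map to `𝟙_0 + 𝟙_y` (telescoping in `ℤ/2`), so `𝟙_0 + 𝟙_y` is in the range.
[ours] -/
theorem single_zero_add_single_mem_range_vertexParity (y : Site d L) :
    (Pi.single 0 1 + Pi.single y 1 : Site d L → ZMod 2) ∈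
      LinearMap.range ((vertexParity_isLinear (d := d) (L := L)).mk') := by
  classical
  -- the partial endpoints `z k = (y_0, …, y_{k-1}, 0, …, 0)`
  set z : ℕ → Site d L := fun k => fun i => if (i : ℕ) < k then y i else 0 with hz
  have hz0 : z 0 = 0 := by ext i; simp [hz]
  have hzd : z d = y := by ext i; simp [hz, i.isLt]
  -- one straight segment: from `a` along direction `i`, `n` unit steps, lands at `a + n • e_i`
  have hseg : ∀ (a : Site d L) (i : Fin d) (n : ℕ),
      (Pi.single a 1 + Pi.single (a + n • Pi.single i 1) 1 : Site d L → ZMod 2) ∈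
        LinearMap.range ((vertexParity_isLinear (d := d) (L := L)).mk') := by
    intro a i n
    induction n with
    | zero =>
      have h2 : ∀ b : ZMod 2, b + b = 0 := by decide
      have : (Pi.single a 1 + Pi.single (a + 0 • Pi.single i 1) 1 : Site d L → ZMod 2) = 0 := by
        ext w; simp only [zero_smul, add_zero, Pi.add_apply, Pi.zero_apply]; exact h2 _
      rw [this]; exact Submodule.zero_mem _
    | succ n ih =>
      -- add the unit link from `a + n•e_i` to `a + (n+1)•e_i`
      have hunit : (Pi.single (a + n • Pi.single i 1) 1 + Pi.single (a + (n + 1) • Pi.single i 1) 1 :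
          Site d L → ZMod 2) ∈ LinearMap.range ((vertexParity_isLinear (d := d) (L := L)).mk') := by
        refine ⟨Pi.single (a + n • Pi.single i 1, i) 1, ?_⟩
        rw [IsLinearMap.mk'_apply, vertexParity_single]
        congr 2
        simp only [Site.shift, add_smul, one_smul, add_assoc]
      have hsum := Submodule.add_mem _ ih hunit
      rw [single_add_single_telescope] at hsum
      simpa [Nat.cast_succ] using hsum
  -- concatenate the `d` segments: `z (k+1) = z k + (y k).val • e_k`
  have hstep : ∀ k : ℕ, (hk : k < d) →
      z (k + 1) = z k + (y ⟨k, hk⟩).val • (Pi.single (⟨k, hk⟩ : Fin d) 1 : Site d L) := by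
    intro k hk
    ext i
    rw [Pi.add_apply, Pi.smul_apply]
    by_cases hi : i = ⟨k, hk⟩
    · subst hi
      rw [Pi.single_eq_same, nsmul_eq_mul, mul_one, ZMod.natCast_zmod_val]
      simp [hz]
    · have hik : (i : ℕ) ≠ k := fun h => hi (Fin.ext h)
      have hiff : ((i : ℕ) < k + 1) ↔ ((i : ℕ) < k) :=
        ⟨fun h => lt_of_le_of_ne (Nat.lt_succ_iff.mp h) hik, fun h => Nat.lt_succ_of_lt h⟩
      rw [Pi.single_eq_of_ne hi, smul_zero, add_zero]
      simp [hz, hiff]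
  have hchain : ∀ k : ℕ, k ≤ d → (Pi.single 0 1 + Pi.single (z k) 1 : Site d L → ZMod 2) ∈
      LinearMap.range ((vertexParity_isLinear (d := d) (L := L)).mk') := by
    intro k hk
    induction k with
    | zero =>
      rw [hz0]
      have h0 := single_add_single_telescope (0 : Site d L) 0 0
      rw [add_eq_left] at h0
      rw [h0]; exact Submodule.zero_mem _
    | succ k ih =>
      have hk' : k < d := by omega
      have h1 := ih hk'.le
      have h2 := hseg (z k) ⟨k, hk'⟩ (y ⟨k, hk'⟩).val
      rw [← hstep k hk'] at h2
      have hsum := Submodule.add_mem _ h1 h2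
      rwa [single_add_single_telescope] at hsum
  have := hchain d le_rfl
  rwa [hzd] at this

/-- **`#sites ≤ rank(vertexParity) + 1`**: the vectors `𝟙_0 + 𝟙_y`, `y ≠ 0`, are linearly independent and
lie in the range. [ours] -/
theorem card_site_le_finrank_range_vertexParity_add_one :
    Fintype.card (Site d L) ≤
      Module.finrank (ZMod 2) (LinearMap.range ((vertexParity_isLinear (d := d) (L := L)).mk')) + 1 := by
  classical
  have hli : LinearIndependent (ZMod 2) (fun y : {y : Site d L // y ≠ 0} =>
      (⟨(Pi.single 0 1 + Pi.single (y : Site d L) 1 : Site d L → ZMod 2),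
        single_zero_add_single_mem_range_vertexParity (y : Site d L)⟩ :
        LinearMap.range ((vertexParity_isLinear (d := d) (L := L)).mk'))) := by
    apply LinearIndependent.of_comp (LinearMap.range ((vertexParity_isLinear (d := d) (L := L)).mk')).subtype
    rw [Fintype.linearIndependent_iff]
    intro g hg y
    have heval := congrArg (fun f : Site d L → ZMod 2 => f (y : Site d L)) hg
    simp only [Function.comp_apply, Submodule.coe_subtype, Finset.sum_apply, Pi.smul_apply, Pi.add_apply,
      smul_eq_mul, Pi.zero_apply] at heval
    rw [Finset.sum_eq_single y] at heval
    · have hy0 : (Pi.single (0 : Site d L) (1 : ZMod 2) : Site d L → ZMod 2) (y : Site d L) = 0 := by simp [y.2]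
      rw [hy0, zero_add] at heval
      simpa using heval
    · intro y' _ hy'
      have h1 : (Pi.single (0 : Site d L) (1 : ZMod 2) : Site d L → ZMod 2) (y : Site d L) = 0 := by simp [y.2]
      have h2 : (Pi.single (y' : Site d L) (1 : ZMod 2) : Site d L → ZMod 2) (y : Site d L) = 0 := by
        have : (y : Site d L) ≠ (y' : Site d L) := fun h => hy' (Subtype.ext h).symm
        simp [this]
      rw [h1, h2, add_zero, mul_zero]
    · intro h; exact absurd (Finset.mem_univ y) h
  have hle := hli.fintype_card_le_finrank
  have hcard : Fintype.card {y : Site d L // y ≠ 0} = Fintype.card (Site d L) - 1 := by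
    rw [Fintype.card_subtype_compl, Fintype.card_subtype_eq]
  have hpos : 1 ≤ Fintype.card (Site d L) := Fintype.card_pos
  omega

/-! ## §4 Rank–nullity: `#B + #sites ≤ #links + 1` -/

/-- **THE PARITY BOUND.**  `L ≥ 2`; `B` ranked (`t p` a link of `p`, `rank p < rank p'` whenever `t p` lies on
another `p' ∈ B`).  Then `#B + #sites ≤ #links + 1`: the boundary vectors of `B` are `#B` independent vectors
in the kernel of the vertex-parity map, whose rank is at least `#sites − 1`. [ours] -/
theorem card_add_card_site_le_card_edge_add_one_of_ranked (hL : 2 ≤ L) (B : Finset (Plaquette d L))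
    (t : Plaquette d L → Edge d L)
    (ht : ∀ p ∈ B, t p ∈ ({(p.1, p.2.1.1), (p.1.shift p.2.1.1, p.2.1.2),
        (p.1.shift p.2.1.2, p.2.1.1), (p.1, p.2.1.2)} : Finset (Edge d L)))
    (rank : Plaquette d L → ℕ)
    (hrank : ∀ p ∈ B, ∀ p' ∈ B, p ≠ p' → t p ∈ ({(p'.1, p'.2.1.1), (p'.1.shift p'.2.1.1, p'.2.1.2),
        (p'.1.shift p'.2.1.2, p'.2.1.1), (p'.1, p'.2.1.2)} : Finset (Edge d L)) → rank p < rank p') :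
    B.card + Fintype.card (Site d L) ≤ Fintype.card (Edge d L) + 1 := by
  classical
  have h4 := card_site_le_finrank_range_vertexParity_add_one (d := d) (L := L)
  set φ : (Edge d L → ZMod 2) →ₗ[ZMod 2] (Site d L → ZMod 2) :=
    (vertexParity_isLinear (d := d) (L := L)).mk' with hφ
  have hker : ∀ p : B,
      (Pi.single ((p : Plaquette d L).1, (p : Plaquette d L).2.1.1) 1 +
        Pi.single ((p : Plaquette d L).1.shift (p : Plaquette d L).2.1.1, (p : Plaquette d L).2.1.2) 1 +
        Pi.single ((p : Plaquette d L).1.shift (p : Plaquette d L).2.1.2, (p : Plaquette d L).2.1.1) 1 +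
        Pi.single ((p : Plaquette d L).1, (p : Plaquette d L).2.1.2) 1 : Edge d L → ZMod 2) ∈
        LinearMap.ker φ := by
    intro p
    rw [LinearMap.mem_ker, hφ, IsLinearMap.mk'_apply]
    exact vertexParity_boundaryVec (p : Plaquette d L)
  have hliK : LinearIndependent (ZMod 2) (fun p : B => (⟨_, hker p⟩ : LinearMap.ker φ)) := by
    apply LinearIndependent.of_comp (LinearMap.ker φ).subtype
    exact linearIndependent_boundaryVec_of_ranked hL B t ht rank hrank
  have h1 : Fintype.card B ≤ Module.finrank (ZMod 2) (LinearMap.ker φ) := hliK.fintype_card_le_finrank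
  have h2 := LinearMap.finrank_range_add_finrank_ker φ
  have h3 : Module.finrank (ZMod 2) (Edge d L → ZMod 2) = Fintype.card (Edge d L) :=
    Module.finrank_fintype_fun_eq_card _
  rw [Fintype.card_coe] at h1
  omega

/-- **Consequence: `#plaquettes + #sites ≤ k + #links + 1`** (`k = #Bᶜ`) for every ranked structure —
`k ≥ C(d,2)·L^d − (d−1)·L^d − 1 = (d−1)(d−2)/2·L^d − 1`, the leading term of the layers
(`TorusRankedLayers`: `k = (d−1)(d−2)/2·L^d + (d−1)·L^{d−1}` attained). [ours] -/
theorem card_plaquette_add_card_site_le_of_ranked (hL : 2 ≤ L) (B : Finset (Plaquette d L))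
    (t : Plaquette d L → Edge d L)
    (ht : ∀ p ∈ B, t p ∈ ({(p.1, p.2.1.1), (p.1.shift p.2.1.1, p.2.1.2),
        (p.1.shift p.2.1.2, p.2.1.1), (p.1, p.2.1.2)} : Finset (Edge d L)))
    (rank : Plaquette d L → ℕ)
    (hrank : ∀ p ∈ B, ∀ p' ∈ B, p ≠ p' → t p ∈ ({(p'.1, p'.2.1.1), (p'.1.shift p'.2.1.1, p'.2.1.2),
        (p'.1.shift p'.2.1.2, p'.2.1.1), (p'.1, p'.2.1.2)} : Finset (Edge d L)) → rank p < rank p') :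
    Fintype.card (Plaquette d L) + Fintype.card (Site d L) ≤
      (Finset.univ \ B).card + Fintype.card (Edge d L) + 1 := by
  have h := card_add_card_site_le_card_edge_add_one_of_ranked hL B t ht rank hrank
  have hc : (Finset.univ \ B).card = Fintype.card (Plaquette d L) - B.card := Finset.card_univ_sdiff B
  have hB : B.card ≤ Fintype.card (Plaquette d L) := Finset.card_le_univ B
  omega

/-- **`d = 3`: `L³ ≤ k + 1`** for every ranked structure of `(ℤ/L)³` (`L ≥ 2`) — twice the cube-counting
floor `L³/2` of `Scaling/AutoregressiveGaugeHeatBathDimensionGap`, and the leading term of the `L³ + 2L²`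
attained by the layers. [ours] -/
theorem pow_three_le_card_compl_add_one_of_ranked (hL : 2 ≤ L) (B : Finset (Plaquette 3 L))
    (t : Plaquette 3 L → Edge 3 L)
    (ht : ∀ p ∈ B, t p ∈ ({(p.1, p.2.1.1), (p.1.shift p.2.1.1, p.2.1.2),
        (p.1.shift p.2.1.2, p.2.1.1), (p.1, p.2.1.2)} : Finset (Edge 3 L)))
    (rank : Plaquette 3 L → ℕ)
    (hrank : ∀ p ∈ B, ∀ p' ∈ B, p ≠ p' → t p ∈ ({(p'.1, p'.2.1.1), (p'.1.shift p'.2.1.1, p'.2.1.2),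
        (p'.1.shift p'.2.1.2, p'.2.1.1), (p'.1, p'.2.1.2)} : Finset (Edge 3 L)) → rank p < rank p') :
    L ^ 3 ≤ (Finset.univ \ B).card + 1 := by
  have h := card_plaquette_add_card_site_le_of_ranked hL B t ht rank hrank
  have hP := two_mul_card_plaquette 3 L
  rw [Summit.Ventures.LatticeQCDFlow.Runbook.card_site] at h hP
  rw [Summit.Ventures.LatticeQCDFlow.Runbook.card_edge] at h
  omega

end Summit.Ventures.LatticeQCDFlow.Theory2.Autoregressive
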